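import Summits.Ventures.CertifiedManyBodySolver.Observables.RungLeavesCoverageNdNiO2ResidualDensityBundlesCaps
import HarnessLib

/-!
# Ventures/CertifiedManyBodySolver — Observables/RungLeavesCoverageNdNiO2ResidualDensityBundlesTwoStations.lean

HONEST FRAMING: one-sided certified CEILINGS on the uniform flux stiffness on the DOWNFOLDED d⁹-nickelate box of record `boxNdNiO2E_M21` (NdNiO₂ parent
film; router/BOXES/NdNiO2.md «1BH+3BE», SCREENING-GRADE) — wording class (xx1): CONTROL / CALIBRATION + labelled heuristic; a ceiling never speaks to the
presence of superconductivity; never «certified true negative / positive»; not a `T_c` or phase-diagram statement; no summit statement is proved here.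
CONDITIONAL closer only: the conclusion is conditional BY NAME on the bundle rows and cap tables it names; floors node-free; no number of record is asserted;
no `sorry`; no definition; zero compute.

Cells `pub/hubbard-obs` ∧ `pub/hubbard-downfold` (MO-S2 ∧ MO-S1, D-0154 (1)(C) COVERAGE material (iii) NdNiO₂), seat `hubbard-cov-ndnio2-unc-3`
(`prover-hubbard-cov-ndnio2-unc-3-g2-0`; DENSITY lane; write_cruxes stmt-Ventures-26751 `ResidualLowUSlab` / stmt-Ventures-26752 `ResidualHighUSlab` of
route-Ventures-CovNdNiO2M21 — SUPPORT, no claim). Fifth part of `Observables/RungLeavesCoverageNdNiO2ResidualDensityBundles{,High,Caps,Box}.lean`.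
THE POINT (an EDITION, the captain's to pick — nothing here recommends it). Every one-station edition of the residual cell has the same binding far vertex
V2 `(5, 477/500, −276/425)` (free-value room `+4.9 %` [float, captain NDNIO2-COVERAGE-PLAN §3]). Now that station-6 parents exist («ndnio2-gen-D»: `(6, 477/500)`,
`t′ ∈ {−253/425, −11/20, −23/50, −11/25}`) and node-free station-6 caps are typed (hubbard-cov-ndnio2-unc-1 g3, `Certificates/HubbardSquare_NdBoxE_station6_afChordCaps.lean`:
`ndBoxE_station6_afChordCap_segA6/segBC`), the apex geometry allows a TWO-STATION reading of the LOW slab that needs NO source beyond `s = −161/300 = −0.5367` at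
station 5 and none beyond `−161/325 = −0.4954` at station 6: targets `U ∈ [5, 6]` are served by station 5 (sources `t′(2 − 5/U) ∈ [p(2 − 5/6), q] = [−161/300, −11/25]`,
inside the V4–V1 bundle B and the V1–V3′ bundle C), targets `U ∈ [6, 13/2]` by station 6 (sources `[p(2 − 12/13), q] = [−161/325, −11/25]`, inside the station-6 bundles
B6 `[−11/20, −23/50]` and C6 `[−23/50, −11/25]`). Together with part 3's `ndM21_residualHighUSlab_of_station6_bundleRowsWN_capTables` (High slab from station 6, sources
`[−253/425, −154/325]`) this words BOTH cruxes WITHOUT the vertex V2 and without any segment-A bundle at station 5; the price is four station-6 bundle rows.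

* §13 `ndM21_residualLowUSlab_of_twoStations_bundleRowsWN_capTables Uo` — eight bundle rows (objectives `−X₀(−23/50)`, `−X₀(−11/25)`: station 5 with `U`-slot `5` on
  B5 `⊇ [−161/300, −23/50]` and C5 `⊇ [−23/50, −11/25]`; station 6 with any `U`-slot label `Uo` on B6 `⊇ [−161/325, −23/50]` and C6 `⊇ [−23/50, −11/25]`), four cap tables in
  binder shape (`U ≤ 5` on B5/C5 — W1 `ndM21res_capW1_segB/segC h396 hVLc` or unc-1's `ndBoxE_station5_afChordCap_segBC`; `U ≤ 6` on B6/C6 — `ndBoxE_station6_afChordCap_segBC`),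
  thresholds (`lo ≤ −12879/6250` on the B-parts = this seat's `ndBoxE_floorRow_tpm23o50_n477o500` literal, `lo ≤ −6678/3125` on the C-parts; `C ≤ hi`), 24 end prices,
  `c ≤ 4779578/10⁷` ⇒ LITERALLY the statement of `Theses.CovNdNiO2M21.ResidualLowUSlab` (`le_total U 6`; unc-2's box theorem twice: `(U_A, U_max) = (5, 6)` and `(6, 13/2)`).

NOT said: that any bundle certificate exists; that station-6 windows are tight enough (P1 j303629 at `(6, 19/20, −23/50)` read `0.4392791` — one point); a number of record.

References: T. Koma, H. Tasaki, J. Stat. Phys. 76 (1994) 745, §1 [KomaTasaki1994]; D. J. Scalapino, S. R. White, S.-C. Zhang, PRB 47 (1993) 7995, §II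
[ScalapinoWhiteZhang1993]; S. Boyd, L. Vandenberghe, *Convex Optimization* (2004) §5.9 [BoydVandenberghe2004]; T. Hazra, N. Verma, M. Randeria, PRX 9 (2019) 031049,
eq. (4) [HazraVermaRanderia2019].
-/

noncomputable section

namespace Summit.Ventures.CertifiedManyBodySolver.Observables

open Set Filter Topology
open Summit.Ventures.CertifiedManyBodySolver.Downfold
open Summit.Ventures.CertifiedManyBodySolver.Certificates
open Literature.MathematicalPhysics.QuantumLattice Literature.MathematicalPhysics.QuantumLattice.ThermodynamicLimit
open Literature.Probability.LatticeModels
open Matrix HubbardWave0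
open scoped BigOperators ComplexOrder

/-! ## §13 The LOW slab from TWO stations: `U ∈ [5, 6]` from station 5 (B, C), `U ∈ [6, 13/2]` from station 6 (B6, C6) — no V2, no segment A -/

section TwoStations

/-- The two-station segment ends: `(−23/50)(2 − 5/6) = −161/300` (station 5 serving `U ≤ 6`) and `(−23/50)(2 − 6/(13/2)) = −161/325` (station 6 serving `U ≤ 13/2`). [folklore] -/
theorem ndM21_twoStations_segment_ends :
    (-23 / 50 : ℝ) * (2 - (5 : ℝ) / (6 : ℝ)) = -(161 / 300) ∧ (-23 / 50 : ℝ) * (2 - (6 : ℝ) / (13 / 2 : ℝ)) = -(161 / 325) := by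
  constructor <;> norm_num

/-- **Rectangle FLOORS on the two-station sub-segments × R‴** (node-free, every `U ≥ 0`): `[−161/300, −23/50]` and `[−161/325, −23/50]`: `−12879/6250 ≤ e₀` (the Γ-regime
constant `−4(1 − 23/50)·477/500` dominates `4s` on both); `[−23/50, −11/25]`: `−6678/3125 ≤ e₀`. [cite: LiebLoss1993, §8, Theorem 8.2] -/
theorem ndM21_twoStations_rectFloors {U : ℝ} (hU : 0 ≤ U) :
    (∀ s ∈ Set.Icc (-(161 / 300) : ℝ) (-23 / 50), ∀ x ∈ Set.Icc (183 / 200 : ℝ) (477 / 500),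
        (((-12879 / 6250 : ℚ)) : ℝ) ≤ energyDensityTT' 1 s U x) ∧
      (∀ s ∈ Set.Icc (-(161 / 325) : ℝ) (-23 / 50), ∀ x ∈ Set.Icc (183 / 200 : ℝ) (477 / 500),
        (((-12879 / 6250 : ℚ)) : ℝ) ≤ energyDensityTT' 1 s U x) ∧
      (∀ s ∈ Set.Icc (-23 / 50 : ℝ) (-11 / 25), ∀ x ∈ Set.Icc (183 / 200 : ℝ) (477 / 500),
        (((-6678 / 3125 : ℚ)) : ℝ) ≤ energyDensityTT' 1 s U x) := by
  refine ⟨fun s hs x hx => le_trans ?_ (bandBottomFloor_on_rect hU (by norm_num) (by norm_num) s hs x hx),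
    fun s hs x hx => le_trans ?_ (bandBottomFloor_on_rect hU (by norm_num) (by norm_num) s hs x hx),
    fun s hs x hx => le_trans ?_ (bandBottomFloor_on_rect hU (by norm_num) (by norm_num) s hs x hx)⟩
  · rw [min_eq_right (by norm_num)]; norm_num
  · rw [min_eq_right (by norm_num)]; norm_num
  · rw [min_eq_right (by norm_num)]; norm_num

/-- **`ResidualLowUSlab` FROM TWO STATIONS (5 | 6), over cap TABLES.** Station 5 (`U`-slot `5` in the objectives, as in the registered stubs): bundle rows `P`, `Q` on B5
`[sB₁, sB₂] ⊇ [−161/300, −23/50]` and C5 `[sC₁, sC₂] ⊇ [−23/50, −11/25]`; station 6 (objective `U`-slot label `Uo` arbitrary, `oddMomentObsTT_lam_zero`): rows `P`, `Q` on B6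
`[tB₁, tB₂] ⊇ [−161/325, −23/50]` and C6 `[tC₁, tC₂] ⊇ [−23/50, −11/25]`; cap tables in binder shape (`U ≤ 5` for B5/C5, `U ≤ 6` for B6/C6; free endpoints, `n₁ ≤ 183/200`);
thresholds `lo ≤ −12879/6250` (B-parts) / `−6678/3125` (C-parts), `C ≤ hi`; 24 end prices `≤ c`; `c ≤ 4779578/10⁷` ⇒ the statement of `Theses.CovNdNiO2M21.ResidualLowUSlab`:
strip `n ≤ 183/200` by `ndnio2_M21_lowFillingCell183_below_bar`; `U ≤ 6` by unc-2's box theorem at `(U_A, U_max) = (5, 6)` (sources `[−161/300, −11/25]`), `U ≥ 6` by the same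
theorem at `(6, 13/2)` (sources `[−161/325, −11/25]`). CONDITIONAL on the eight rows and four tables; no number asserted.
[cite: KomaTasaki1994, §1] [cite: ScalapinoWhiteZhang1993, §II] [cite: BoydVandenberghe2004, §5.9] [cite: HazraVermaRanderia2019, eq. (4)] -/
theorem ndM21_residualLowUSlab_of_twoStations_bundleRowsWN_capTables (Uo : ℝ)
    {sB₁ sB₂ sC₁ sC₂ tB₁ tB₂ tC₁ tC₂ aB bB nB CB aC bC nC CC aB' bB' nB' CB' aC' bC' nC' CC' : ℝ}
    {loPB hiPB FPB sPB₁ sPB₂ loQB hiQB FQB sQB₁ sQB₂ loPC hiPC FPC sPC₁ sPC₂ loQC hiQC FQC sQC₁ sQC₂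
      loPB' hiPB' FPB' sPB'₁ sPB'₂ loQB' hiQB' FQB' sQB'₁ sQB'₂ loPC' hiPC' FPC' sPC'₁ sPC'₂ loQC' hiQC' FQC' sQC'₁ sQC'₂ c : ℚ}
    -- station 5 rows (B5, C5)
    (hPB : TPrimeBundleOrbitLowerRowWN 5 sB₁ sB₂ loPB hiPB FPB sPB₁ sPB₂ (477 / 500) (fun _ => -oddMomentObsTT (-23 / 50) 5 0))
    (hQB : TPrimeBundleOrbitLowerRowWN 5 sB₁ sB₂ loQB hiQB FQB sQB₁ sQB₂ (477 / 500) (fun _ => -oddMomentObsTT (-11 / 25) 5 0))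
    (hPC : TPrimeBundleOrbitLowerRowWN 5 sC₁ sC₂ loPC hiPC FPC sPC₁ sPC₂ (477 / 500) (fun _ => -oddMomentObsTT (-23 / 50) 5 0))
    (hQC : TPrimeBundleOrbitLowerRowWN 5 sC₁ sC₂ loQC hiQC FQC sQC₁ sQC₂ (477 / 500) (fun _ => -oddMomentObsTT (-11 / 25) 5 0))
    -- station 6 rows (B6, C6)
    (hPB' : TPrimeBundleOrbitLowerRowWN 6 tB₁ tB₂ loPB' hiPB' FPB' sPB'₁ sPB'₂ (477 / 500) (fun _ => -oddMomentObsTT (-23 / 50) Uo 0))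
    (hQB' : TPrimeBundleOrbitLowerRowWN 6 tB₁ tB₂ loQB' hiQB' FQB' sQB'₁ sQB'₂ (477 / 500) (fun _ => -oddMomentObsTT (-11 / 25) Uo 0))
    (hPC' : TPrimeBundleOrbitLowerRowWN 6 tC₁ tC₂ loPC' hiPC' FPC' sPC'₁ sPC'₂ (477 / 500) (fun _ => -oddMomentObsTT (-23 / 50) Uo 0))
    (hQC' : TPrimeBundleOrbitLowerRowWN 6 tC₁ tC₂ loQC' hiQC' FQC' sQC'₁ sQC'₂ (477 / 500) (fun _ => -oddMomentObsTT (-11 / 25) Uo 0))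
    (hB₁ : sB₁ ≤ -(161 / 300)) (hB₂ : (-23 / 50 : ℝ) ≤ sB₂) (hC₁ : sC₁ ≤ -23 / 50) (hC₂ : (-11 / 25 : ℝ) ≤ sC₂)
    (hB₁' : tB₁ ≤ -(161 / 325)) (hB₂' : (-23 / 50 : ℝ) ≤ tB₂) (hC₁' : tC₁ ≤ -23 / 50) (hC₂' : (-11 / 25 : ℝ) ≤ tC₂)
    -- cap tables (binder shape) and their side conditions
    (hcapB : ∀ U s n : ℝ, 0 ≤ U → U ≤ 5 → aB ≤ s → s ≤ bB → nB ≤ n → n ≤ 477 / 500 → energyDensityTT' 1 s U n ≤ CB)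
    (hcapC : ∀ U s n : ℝ, 0 ≤ U → U ≤ 5 → aC ≤ s → s ≤ bC → nC ≤ n → n ≤ 477 / 500 → energyDensityTT' 1 s U n ≤ CC)
    (hcapB' : ∀ U s n : ℝ, 0 ≤ U → U ≤ 6 → aB' ≤ s → s ≤ bB' → nB' ≤ n → n ≤ 477 / 500 → energyDensityTT' 1 s U n ≤ CB')
    (hcapC' : ∀ U s n : ℝ, 0 ≤ U → U ≤ 6 → aC' ≤ s → s ≤ bC' → nC' ≤ n → n ≤ 477 / 500 → energyDensityTT' 1 s U n ≤ CC')
    (haB : aB ≤ -(161 / 300)) (hbB : (-23 / 50 : ℝ) ≤ bB) (hnB : nB ≤ 183 / 200)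
    (haC : aC ≤ -23 / 50) (hbC : (-11 / 25 : ℝ) ≤ bC) (hnC : nC ≤ 183 / 200)
    (haB' : aB' ≤ -(161 / 325)) (hbB' : (-23 / 50 : ℝ) ≤ bB') (hnB' : nB' ≤ 183 / 200)
    (haC' : aC' ≤ -23 / 50) (hbC' : (-11 / 25 : ℝ) ≤ bC') (hnC' : nC' ≤ 183 / 200)
    -- thresholds on the rows' window literals
    (hloPB : loPB ≤ -12879 / 6250) (hloQB : loQB ≤ -12879 / 6250) (hloPC : loPC ≤ -6678 / 3125) (hloQC : loQC ≤ -6678 / 3125)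
    (hloPB' : loPB' ≤ -12879 / 6250) (hloQB' : loQB' ≤ -12879 / 6250) (hloPC' : loPC' ≤ -6678 / 3125) (hloQC' : loQC' ≤ -6678 / 3125)
    (hhiPB : CB ≤ ((hiPB : ℚ) : ℝ)) (hhiQB : CB ≤ ((hiQB : ℚ) : ℝ)) (hhiPC : CC ≤ ((hiPC : ℚ) : ℝ)) (hhiQC : CC ≤ ((hiQC : ℚ) : ℝ))
    (hhiPB' : CB' ≤ ((hiPB' : ℚ) : ℝ)) (hhiQB' : CB' ≤ ((hiQB' : ℚ) : ℝ)) (hhiPC' : CC' ≤ ((hiPC' : ℚ) : ℝ)) (hhiQC' : CC' ≤ ((hiQC' : ℚ) : ℝ))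
    -- end prices
    (pPB : -FPB - sPB₁ * (183 / 200 - 477 / 500) ≤ c ∧ -FPB - sPB₂ * (183 / 200 - 477 / 500) ≤ c ∧ -FPB ≤ c)
    (pQB : -FQB - sQB₁ * (183 / 200 - 477 / 500) ≤ c ∧ -FQB - sQB₂ * (183 / 200 - 477 / 500) ≤ c ∧ -FQB ≤ c)
    (pPC : -FPC - sPC₁ * (183 / 200 - 477 / 500) ≤ c ∧ -FPC - sPC₂ * (183 / 200 - 477 / 500) ≤ c ∧ -FPC ≤ c)
    (pQC : -FQC - sQC₁ * (183 / 200 - 477 / 500) ≤ c ∧ -FQC - sQC₂ * (183 / 200 - 477 / 500) ≤ c ∧ -FQC ≤ c)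
    (pPB' : -FPB' - sPB'₁ * (183 / 200 - 477 / 500) ≤ c ∧ -FPB' - sPB'₂ * (183 / 200 - 477 / 500) ≤ c ∧ -FPB' ≤ c)
    (pQB' : -FQB' - sQB'₁ * (183 / 200 - 477 / 500) ≤ c ∧ -FQB' - sQB'₂ * (183 / 200 - 477 / 500) ≤ c ∧ -FQB' ≤ c)
    (pPC' : -FPC' - sPC'₁ * (183 / 200 - 477 / 500) ≤ c ∧ -FPC' - sPC'₂ * (183 / 200 - 477 / 500) ≤ c ∧ -FPC' ≤ c)
    (pQC' : -FQC' - sQC'₁ * (183 / 200 - 477 / 500) ≤ c ∧ -FQC' - sQC'₂ * (183 / 200 - 477 / 500) ≤ c ∧ -FQC' ≤ c)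
    (hc : c ≤ 4779578 / 10000000) :
    ∀ tp ∈ Set.Icc (-23 / 50 : ℝ) (-11 / 25), ∀ U ∈ Set.Icc (5 : ℝ) (13 / 2), ∀ n ∈ Set.Icc (9 / 10 : ℝ) (477 / 500),
      ObsStiffnessSeqCeilingAt tp U n (4779578 / 10000000) := by
  intro tp htp U hU n hn
  rcases le_total n (183 / 200) with hlow | hhigh
  · exact ndnio2_M21_lowFillingCell183_below_bar (U := U) htp ⟨by linarith [hn.1], hlow⟩
  have hn' : n ∈ Set.Icc (183 / 200 : ℝ) (477 / 500) := ⟨hhigh, hn.2⟩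
  have h5 : (0 : ℝ) ≤ 5 := by norm_num
  have h6 : (0 : ℝ) ≤ 6 := by norm_num
  have x0 : (0 : ℝ) ≤ 183 / 200 := by norm_num
  have x2 : (477 / 500 : ℝ) < 2 := by norm_num
  obtain ⟨e5, e6⟩ := ndM21_twoStations_segment_ends
  obtain ⟨flB5, -, flC5⟩ := ndM21_twoStations_rectFloors (U := (5 : ℝ)) h5
  obtain ⟨-, flB6, flC6⟩ := ndM21_twoStations_rectFloors (U := (6 : ℝ)) h6
  -- windows from the tables
  have wPB := bundleWindow_of_capTable h5 hcapB haB hbB hnB flB5 hloPB hhiPB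
  have wQB := bundleWindow_of_capTable h5 hcapB haB hbB hnB flB5 hloQB hhiQB
  have wPC := bundleWindow_of_capTable h5 hcapC haC hbC hnC flC5 hloPC hhiPC
  have wQC := bundleWindow_of_capTable h5 hcapC haC hbC hnC flC5 hloQC hhiQC
  have wPB' := bundleWindow_of_capTable h6 hcapB' haB' hbB' hnB' flB6 hloPB' hhiPB'
  have wQB' := bundleWindow_of_capTable h6 hcapB' haB' hbB' hnB' flB6 hloQB' hhiQB'
  have wPC' := bundleWindow_of_capTable h6 hcapC' haC' hbC' hnC' flC6 hloPC' hhiPC'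
  have wQC' := bundleWindow_of_capTable h6 hcapC' haC' hbC' hnC' flC6 hloQC' hhiQC'
  -- families at the density `n`
  have fPB := orbitLowerOn_subrect_of_bundleRowWN hPB hB₁ hB₂ x0 x2 wPB n hn'
  have fQB := orbitLowerOn_subrect_of_bundleRowWN hQB hB₁ hB₂ x0 x2 wQB n hn'
  have fPC := orbitLowerOn_subrect_of_bundleRowWN hPC hC₁ hC₂ x0 x2 wPC n hn'
  have fQC := orbitLowerOn_subrect_of_bundleRowWN hQC hC₁ hC₂ x0 x2 wQC n hn'
  have fPB' := orbitLowerOn_subrect_of_bundleRowWN hPB' hB₁' hB₂' x0 x2 wPB' n hn'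
  have fQB' := orbitLowerOn_subrect_of_bundleRowWN hQB' hB₁' hB₂' x0 x2 wQB' n hn'
  have fPC' := orbitLowerOn_subrect_of_bundleRowWN hPC' hC₁' hC₂' x0 x2 wPC' n hn'
  have fQC' := orbitLowerOn_subrect_of_bundleRowWN hQC' hC₁' hC₂' x0 x2 wQC' n hn'
  -- prices at the density `n`
  have cPB := neg_wnBundleValue_le_on_R3_of_ends pPB.1 pPB.2.1 pPB.2.2 n hn'
  have cQB := neg_wnBundleValue_le_on_R3_of_ends pQB.1 pQB.2.1 pQB.2.2 n hn'
  have cPC := neg_wnBundleValue_le_on_R3_of_ends pPC.1 pPC.2.1 pPC.2.2 n hn'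
  have cQC := neg_wnBundleValue_le_on_R3_of_ends pQC.1 pQC.2.1 pQC.2.2 n hn'
  have cPB' := neg_wnBundleValue_le_on_R3_of_ends pPB'.1 pPB'.2.1 pPB'.2.2 n hn'
  have cQB' := neg_wnBundleValue_le_on_R3_of_ends pQB'.1 pQB'.2.1 pQB'.2.2 n hn'
  have cPC' := neg_wnBundleValue_le_on_R3_of_ends pPC'.1 pPC'.2.1 pPC'.2.2 n hn'
  have cQC' := neg_wnBundleValue_le_on_R3_of_ends pQC'.1 pQC'.2.1 pQC'.2.2 n hn'
  -- the idle `U`-slot of the station-6 objectives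
  have labP : -oddMomentObsTT (-23 / 50) Uo 0 = -oddMomentObsTT (-23 / 50) 6 0 := by
    rw [oddMomentObsTT_lam_zero (-23 / 50) Uo, oddMomentObsTT_lam_zero (-23 / 50) 6]
  have labQ : -oddMomentObsTT (-11 / 25) Uo 0 = -oddMomentObsTT (-11 / 25) 6 0 := by
    rw [oddMomentObsTT_lam_zero (-11 / 25) Uo, oddMomentObsTT_lam_zero (-11 / 25) 6]
  rcases le_total U 6 with hU6 | hU6
  · -- `U ∈ [5, 6]` from station 5, sources `[−161/300, −11/25]`
    refine (ObsStiffnessSeqCeilingAt_on_box_of_apexStation_twoEndObjectives (p := -23 / 50) (q := -11 / 25) (UA := (5 : ℝ))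
      (Umax := (6 : ℝ)) (n := n) (by norm_num) (by norm_num) (by norm_num) (by linarith [hn'.1]) (by linarith [hn'.2])
      (fun s => if s ≤ -23 / 50 then wnBundleValue FPB sPB₁ sPB₂ (477 / 500) n else wnBundleValue FPC sPC₁ sPC₂ (477 / 500) n)
      (fun s => if s ≤ -23 / 50 then wnBundleValue FQB sQB₁ sQB₂ (477 / 500) n else wnBundleValue FQC sQC₁ sQC₂ (477 / 500) n)
      c ?_ ?_ ?_ tp htp U ⟨hU.1, hU6⟩).mono hc
    · intro s hs ω Ls ψ hLs hψ h1 hω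
      rw [e5] at hs
      by_cases hs1 : s ≤ -23 / 50
      · simp only [if_pos hs1]; exact fPB s ⟨hs.1, hs1⟩ ω Ls ψ hLs hψ h1 hω
      · simp only [if_neg hs1]; exact fPC s ⟨(not_le.1 hs1).le, hs.2⟩ ω Ls ψ hLs hψ h1 hω
    · intro s hs ω Ls ψ hLs hψ h1 hω
      rw [e5] at hs
      by_cases hs1 : s ≤ -23 / 50
      · simp only [if_pos hs1]; exact fQB s ⟨hs.1, hs1⟩ ω Ls ψ hLs hψ h1 hω
      · simp only [if_neg hs1]; exact fQC s ⟨(not_le.1 hs1).le, hs.2⟩ ω Ls ψ hLs hψ h1 hω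
    · intro σ hσ s _
      refine neg_slotChord_le_of_neg_le (by norm_num) hσ ?_ ?_
      · by_cases hs1 : s ≤ -23 / 50
        · simp only [if_pos hs1]; exact cPB
        · simp only [if_neg hs1]; exact cPC
      · by_cases hs1 : s ≤ -23 / 50
        · simp only [if_pos hs1]; exact cQB
        · simp only [if_neg hs1]; exact cQC
  · -- `U ∈ [6, 13/2]` from station 6, sources `[−161/325, −11/25]`
    refine (ObsStiffnessSeqCeilingAt_on_box_of_apexStation_twoEndObjectives (p := -23 / 50) (q := -11 / 25) (UA := (6 : ℝ))
      (Umax := (13 / 2 : ℝ)) (n := n) (by norm_num) (by norm_num) (by norm_num) (by linarith [hn'.1]) (by linarith [hn'.2])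
      (fun s => if s ≤ -23 / 50 then wnBundleValue FPB' sPB'₁ sPB'₂ (477 / 500) n else wnBundleValue FPC' sPC'₁ sPC'₂ (477 / 500) n)
      (fun s => if s ≤ -23 / 50 then wnBundleValue FQB' sQB'₁ sQB'₂ (477 / 500) n else wnBundleValue FQC' sQC'₁ sQC'₂ (477 / 500) n)
      c ?_ ?_ ?_ tp htp U ⟨hU6, hU.2⟩).mono hc
    · intro s hs ω Ls ψ hLs hψ h1 hω
      rw [e6] at hs
      rw [← labP]
      by_cases hs1 : s ≤ -23 / 50
      · simp only [if_pos hs1]; exact fPB' s ⟨hs.1, hs1⟩ ω Ls ψ hLs hψ h1 hω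
      · simp only [if_neg hs1]; exact fPC' s ⟨(not_le.1 hs1).le, hs.2⟩ ω Ls ψ hLs hψ h1 hω
    · intro s hs ω Ls ψ hLs hψ h1 hω
      rw [e6] at hs
      rw [← labQ]
      by_cases hs1 : s ≤ -23 / 50
      · simp only [if_pos hs1]; exact fQB' s ⟨hs.1, hs1⟩ ω Ls ψ hLs hψ h1 hω
      · simp only [if_neg hs1]; exact fQC' s ⟨(not_le.1 hs1).le, hs.2⟩ ω Ls ψ hLs hψ h1 hω
    · intro σ hσ s _
      refine neg_slotChord_le_of_neg_le (by norm_num) hσ ?_ ?_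
      · by_cases hs1 : s ≤ -23 / 50
        · simp only [if_pos hs1]; exact cPB'
        · simp only [if_neg hs1]; exact cPC'
      · by_cases hs1 : s ≤ -23 / 50
        · simp only [if_pos hs1]; exact cQB'
        · simp only [if_neg hs1]; exact cQC'

end TwoStations

end Summit.Ventures.CertifiedManyBodySolver.Observables

end
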